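import Literature.AnabelianGeometry.SemiGraphs.TemperedCompactLevelKernelTrees
import Literature.AnabelianGeometry.SemiGraphs.ArithLevelDataCpt

/-!
# Compact subgroups acting trivially on a finite level act trivially on its tree — compact-form
# arithmetic package `ArithLevelDataCpt` ([SemiAnbd] Thm 5.4 (i))

Mochizuki, *Semi-graphs of anabelioids*, Publ. RIMS **42** (2006), §5, Thm. 5.4 (i), author's manuscript
p. 66 [cite: MochizukiSemiAnbd2006, Thm 5.4 (i), p. 66] ("entirely similar to … Theorem 3.7 (iii)",
p. 41: a compact `H` "acts on `𝒢_{∞,i}` … this action factors through a finite quotient … `H` fixes at least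
one vertex"), §1 Prop. 1.1 p. 14 (immersions are rigid).

The twin, for abc-iut-w4-d053's compact/image-form hypothesis package `ArithLevelDataCpt` (p420956, exit
(A54) of finding F-t6g3-1), of `ArithLevelData.act_eq_one_of_levelAct_eq_one`
(TemperedCompactLevelKernelTrees.lean), stated in kernel-membership form: the tree action `act j` covers the finite-level action
`levelAct j` through the immersion `quot j`, so **an element of a COMPACT subgroup of `Π^temp_𝔊` acting
trivially on the finite level `𝔾_j` acts trivially on the tree `𝒢_{∞,j}`** (finite quotient + no branch
switching ⇒ fixed vertex by Lemma 1.8 (ii); rigidity of the immersion `quot j`).  This is the reduction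
«level-trivial ⇒ tree-trivial on compact subgroups» used by the producer of the field (AI4″)
`stabBranchPairAug` (row T54-B).  Proof-only (seat abc-iut-L3-t6); nothing here bears on [IUTchIII]
Cor. 3.12.
-/

namespace Literature.AnabelianGeometry.SemiGraphs

open CategoryTheory Topology

universe v u u' u''

namespace ArithLevelDataCpt

variable {Gtp : Type u'} [Group Gtp] [TopologicalSpace Gtp] [IsTopologicalGroup Gtp] {PA : Type u''}
  [Group PA] {𝔾 : SemiGraph.{u}} {D : DecompositionData Gtp 𝔾.Vertex 𝔾.Branch} {aug : Gtp →* PA}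
  {baseAct : PA →* Aut 𝔾} (L : ArithLevelDataCpt.{v} 𝔾 D aug baseAct)

/-- **Compact-form arithmetic level data ([SemiAnbd] Thm 5.4): an element of a compact subgroup of
`Π^temp_𝔊` acting trivially on the finite level `𝔾_j` acts trivially on the tree `𝒢_{∞,j}`** (finite
quotient + no branch switching `noSwap` ⇒ fixed vertex; `quot j` immersion + `act_quot` ⇒ rigidity).
[cite: MochizukiSemiAnbd2006, Thm 5.4 (i), p. 66] -/
theorem mem_ker_act_of_mem_ker_levelAct (C : Subgroup Gtp) (hC : IsCompact (C : Set Gtp)) {g : Gtp}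
    (hg : g ∈ C) (j : L.J) (htriv : g ∈ (L.levelAct j).ker) : g ∈ (L.act j).ker := by
  rw [MonoidHom.mem_ker] at htriv ⊢
  refine SemiGraph.act_eq_one_of_isCompact_of_noSwap_of_comp_immersion_eq C hC (L.isTree j) (L.vertex j)
    (L.act j) (L.isOpen_ker j) (fun g' b he => L.noSwap j g' b he) (L.quot j) (L.quot_isImmersion j) hg ?_
  rw [L.act_quot j g, htriv]
  exact Category.comp_id _

/-- Joint form for compact-form arithmetic level data: on a compact subgroup the joint kernel of the
finite-level actions lies in the joint kernel of the tree actions.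
[cite: MochizukiSemiAnbd2006, Thm 5.4 (i), p. 66] -/
theorem mem_iInf_ker_act_of_mem_iInf_ker_levelAct (C : Subgroup Gtp) (hC : IsCompact (C : Set Gtp))
    {g : Gtp} (hg : g ∈ C) (htriv : g ∈ ⨅ j, (L.levelAct j).ker) : g ∈ ⨅ j, (L.act j).ker :=
  Subgroup.mem_iInf.2 fun j =>
    L.mem_ker_act_of_mem_ker_levelAct C hC hg j (Subgroup.mem_iInf.1 htriv j)

/-- Subgroup form: a compact subgroup contained in the kernel of every finite-level action is contained
in the kernel of every tree action. [cite: MochizukiSemiAnbd2006, Thm 5.4 (i), p. 66] -/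
theorem le_ker_act_of_le_ker_levelAct (C : Subgroup Gtp) (hC : IsCompact (C : Set Gtp))
    (hle : ∀ j, C ≤ (L.levelAct j).ker) (j : L.J) : C ≤ (L.act j).ker :=
  fun _ hg => L.mem_ker_act_of_mem_ker_levelAct C hC hg j (hle j hg)

/-- Intersected form: `C ⊓ ⨅ⱼ ker (levelAct j) ≤ ⨅ⱼ ker (act j)` for compact `C` — the shape in which
«faithful on compacta at the finite levels» is fed to the (AI4″) producer.
[cite: MochizukiSemiAnbd2006, Thm 5.4 (i), p. 66] -/
theorem inf_iInf_ker_levelAct_le (C : Subgroup Gtp) (hC : IsCompact (C : Set Gtp)) :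
    C ⊓ (⨅ j, (L.levelAct j).ker) ≤ ⨅ j, (L.act j).ker :=
  fun _ hg => L.mem_iInf_ker_act_of_mem_iInf_ker_levelAct C hC hg.1 hg.2

end ArithLevelDataCpt

end Literature.AnabelianGeometry.SemiGraphs
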